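import Summits.NavierStokesRegularity.NavierStokesRegularity.Theorems.CorkscrewDynamoSphereTangentLiouvilleHodgeTools
import Literature.Analysis.FluidPDE.KNSSSwirlLiouville
import Literature.Analysis.FluidPDE.VorticityCalculus
import HarnessLib

/-!
# `SphereTangentLiouville`, IV: the pointwise vorticity equation of the representative and the
# transport equation of `g = ⟪x, curl V⟫`

Support file for item `stmt-NavierStokesRegularity-1365` (route `CorkscrewDynamo`,
NavierStokesRegularity). For the representative `V` of part I — smooth slices, derivatives of
order `≥ 1` Lipschitz in time, order `0` locally Lipschitz in time, the vorticity equation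
`ω(t) − ω(s) = ∫ₛᵗ F`, `F = Δω − Dω[V] + DV[ω]`, `ω = curl V` — the integrand `F(·, x)` is
CONTINUOUS in time (this is where the tangency normalisation of the parasitic drift matters), so
`ω(·, x)` is differentiable with derivative `F`. For a field tangent to the spheres about the
origin the scalar `g(t, x) = ⟪x, ω(t, x)⟫` then satisfies, pointwise and classically,
`∂ₜg = Δg − Dg[V]` (Elsasser's/Bullard–Gellman's identity `(∂ₜ + V·∇ − Δ)(x·ω) = ω·∇(x·V)`
with `x·V ≡ 0`): the input of `tangentDrift_eq_zero`.

* `fderiv_laplacian_apply` — `D(Δf)(x) h = Σᵢ D³f(x)[h, eᵢ, eᵢ]`;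
* `continuousOn_of_norm_sub_le` — Lipschitz in time ⇒ continuous on `(−∞, 0)`;
* `continuousOn_fderiv_fderiv`, `continuousOn_fderiv_laplacian` — time continuity of `D²V(·,x)`,
  `D(ΔV)(·,x)` from the Lipschitz bounds on `iteratedFDeriv 2, 3`;
* `hasDerivAt_curl` — `∂ₜ ω(t, x) = F(t, x)`;
* `inner_vorticityRHS_eq` — `⟪x, F⟫ = Δg − Dg[V]` under tangency;
* `continuousOn_uncurry_inner_curl`, `contDiff_inner_curl` — regularity of `g`.
-/

noncomputable section

open MeasureTheory Set Function Filter InnerProductSpace Metric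
open scoped RealInnerProductSpace Topology Laplacian ContDiff
open Literature.Analysis Literature.Analysis.FluidPDE

set_option linter.dupNamespace false

namespace Summit.NavierStokesRegularity.NavierStokesRegularity.Theorems

/-- **`D(Δf)(x) h = Σᵢ D³f(x)[h, vᵢ, vᵢ]`** for `f ∈ C³` and an orthonormal basis `v`. -/
theorem fderiv_laplacian_apply {E F : Type*} [NormedAddCommGroup E] [InnerProductSpace ℝ E]
    [FiniteDimensional ℝ E] [NormedAddCommGroup F] [NormedSpace ℝ F]
    {ι : Type*} [Fintype ι] (v : OrthonormalBasis ι ℝ E)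
    {f : E → F} (hf : ContDiff ℝ 3 f) (x h : E) :
    fderiv ℝ (Δ f) x h = ∑ i, iteratedFDeriv ℝ 3 f x ![h, v i, v i] := by
  have hd2 : Differentiable ℝ (iteratedFDeriv ℝ 2 f) :=
    hf.differentiable_iteratedFDeriv (by norm_cast)
  rw [laplacian_eq_iteratedFDeriv_orthonormalBasis f v,
    fderiv_fun_sum fun i _ => (hd2 x).continuousMultilinear_apply_const _]
  simp only [_root_.FunLike.coe_sum, Finset.sum_apply]
  refine Finset.sum_congr rfl fun i _ => ?_
  rw [fderiv_continuousMultilinear_apply_const_apply (hd2 x), iteratedFDeriv_succ_apply_left]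
  have h0 : (![h, v i, v i] : Fin 3 → E) 0 = h := rfl
  have htail : Fin.tail (![h, v i, v i] : Fin 3 → E) = ![v i, v i] := by
    funext j; fin_cases j <;> rfl
  rw [h0, htail]

/-- A family which is Lipschitz in time on `(−∞, 0)` is continuous there. -/
theorem continuousOn_of_norm_sub_le {Y : Type*} [SeminormedAddCommGroup Y] {G : ℝ → Y} {L : ℝ}
    (h : ∀ s < 0, ∀ t < 0, ‖G t - G s‖ ≤ L * |t - s|) : ContinuousOn G (Iio 0) := by
  refine (LipschitzOnWith.of_dist_le_mul fun t ht s hs => ?_ : LipschitzOnWith L.toNNReal G (Iio 0)).continuousOn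
  calc dist (G t) (G s) = ‖G t - G s‖ := dist_eq_norm _ _
    _ ≤ L * |t - s| := h s hs t ht
    _ ≤ (L.toNNReal : ℝ) * dist t s := by
        rw [Real.dist_eq]
        exact mul_le_mul_of_nonneg_right (Real.le_coe_toNNReal L) (abs_nonneg _)

section Family

variable {V : ℝ → EuclideanSpace ℝ (Fin 3) → EuclideanSpace ℝ (Fin 3)}

/-- Time continuity of `t ↦ DV(t, x)` from the Lipschitz bound on `iteratedFDeriv 1`. -/
theorem continuousOn_fderiv_of_lipschitz {L : ℝ}
    (hL : ∀ s < 0, ∀ t < 0, ∀ x, ‖iteratedFDeriv ℝ 1 (V t) x - iteratedFDeriv ℝ 1 (V s) x‖ ≤ L * |t - s|)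
    (x : EuclideanSpace ℝ (Fin 3)) : ContinuousOn (fun t => fderiv ℝ (V t) x) (Iio 0) := by
  refine continuousOn_of_norm_sub_le (G := fun t => fderiv ℝ (V t) x) (L := L) fun s hs t ht => ?_
  refine ContinuousLinearMap.opNorm_le_bound _ ((norm_nonneg _).trans (hL s hs t ht x)) fun h => ?_
  have key : (fderiv ℝ (V t) x - fderiv ℝ (V s) x) h =
      (iteratedFDeriv ℝ 1 (V t) x - iteratedFDeriv ℝ 1 (V s) x) (fun _ => h) := by
    change fderiv ℝ (V t) x h - fderiv ℝ (V s) x h =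
      iteratedFDeriv ℝ 1 (V t) x (fun _ => h) - iteratedFDeriv ℝ 1 (V s) x (fun _ => h)
    rw [iteratedFDeriv_one_apply, iteratedFDeriv_one_apply]
  rw [key]
  refine (ContinuousMultilinearMap.le_opNorm _ _).trans ?_
  rw [Fin.prod_univ_one]
  exact mul_le_mul_of_nonneg_right (hL s hs t ht x) (norm_nonneg _)

/-- Time continuity of `t ↦ D²V(t, x)` from the Lipschitz bound on `iteratedFDeriv 2`. -/
theorem continuousOn_fderiv_fderiv_of_lipschitz {L : ℝ}
    (hL : ∀ s < 0, ∀ t < 0, ∀ x, ‖iteratedFDeriv ℝ 2 (V t) x - iteratedFDeriv ℝ 2 (V s) x‖ ≤ L * |t - s|)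
    (x : EuclideanSpace ℝ (Fin 3)) :
    ContinuousOn (fun t => fderiv ℝ (fderiv ℝ (V t)) x) (Iio 0) := by
  refine continuousOn_of_norm_sub_le (G := fun t => fderiv ℝ (fderiv ℝ (V t)) x) (L := L)
    fun s hs t ht => ?_
  have hL0 : 0 ≤ L * |t - s| := (norm_nonneg _).trans (hL s hs t ht x)
  refine ContinuousLinearMap.opNorm_le_bound _ hL0 fun h => ?_
  refine ContinuousLinearMap.opNorm_le_bound _ (mul_nonneg hL0 (norm_nonneg _)) fun k => ?_
  have key : (fderiv ℝ (fderiv ℝ (V t)) x - fderiv ℝ (fderiv ℝ (V s)) x) h k =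
      (iteratedFDeriv ℝ 2 (V t) x - iteratedFDeriv ℝ 2 (V s) x) ![h, k] := by
    change fderiv ℝ (fderiv ℝ (V t)) x h k - fderiv ℝ (fderiv ℝ (V s)) x h k =
      iteratedFDeriv ℝ 2 (V t) x ![h, k] - iteratedFDeriv ℝ 2 (V s) x ![h, k]
    rw [iteratedFDeriv_two_apply, iteratedFDeriv_two_apply]
    rfl
  rw [key]
  refine (ContinuousMultilinearMap.le_opNorm _ _).trans ?_
  rw [Fin.prod_univ_two]
  simp only [Matrix.cons_val_zero, Matrix.cons_val_one]
  rw [← mul_assoc]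
  exact mul_le_mul_of_nonneg_right (mul_le_mul_of_nonneg_right (hL s hs t ht x) (norm_nonneg _))
    (norm_nonneg _)

/-- Time continuity of `t ↦ D(ΔV)(t, x)` from the Lipschitz bound on `iteratedFDeriv 3`. -/
theorem continuousOn_fderiv_laplacian_of_lipschitz {L : ℝ} (hs3 : ∀ t < 0, ContDiff ℝ 3 (V t))
    (hL : ∀ s < 0, ∀ t < 0, ∀ x, ‖iteratedFDeriv ℝ 3 (V t) x - iteratedFDeriv ℝ 3 (V s) x‖ ≤ L * |t - s|)
    (x : EuclideanSpace ℝ (Fin 3)) :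
    ContinuousOn (fun t => fderiv ℝ (Δ (V t)) x) (Iio 0) := by
  set v := EuclideanSpace.basisFun (Fin 3) ℝ with hv
  refine continuousOn_of_norm_sub_le (G := fun t => fderiv ℝ (Δ (V t)) x) (L := 3 * L)
    fun s hs t ht => ?_
  have hL0 : 0 ≤ L * |t - s| := (norm_nonneg _).trans (hL s hs t ht x)
  refine ContinuousLinearMap.opNorm_le_bound _ (by nlinarith [hL0]) fun h => ?_
  have key : (fderiv ℝ (Δ (V t)) x - fderiv ℝ (Δ (V s)) x) h =
      ∑ i, (iteratedFDeriv ℝ 3 (V t) x - iteratedFDeriv ℝ 3 (V s) x) ![h, v i, v i] := by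
    change fderiv ℝ (Δ (V t)) x h - fderiv ℝ (Δ (V s)) x h = _
    rw [fderiv_laplacian_apply v (hs3 t ht), fderiv_laplacian_apply v (hs3 s hs),
      ← Finset.sum_sub_distrib]
    rfl
  rw [key]
  refine (norm_sum_le _ _).trans ?_
  have hvi : ∀ i, ‖v i‖ = 1 := fun i => v.orthonormal.norm_eq_one i
  have hterm : ∀ i, ‖(iteratedFDeriv ℝ 3 (V t) x - iteratedFDeriv ℝ 3 (V s) x) ![h, v i, v i]‖ ≤
      L * |t - s| * ‖h‖ := fun i => by
    refine (ContinuousMultilinearMap.le_opNorm _ _).trans ?_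
    rw [Fin.prod_univ_three]
    simp only [Matrix.cons_val_zero, Matrix.cons_val_one, Matrix.cons_val, hvi, mul_one]
    exact mul_le_mul_of_nonneg_right (hL s hs t ht x) (norm_nonneg _)
  calc ∑ i, ‖(iteratedFDeriv ℝ 3 (V t) x - iteratedFDeriv ℝ 3 (V s) x) ![h, v i, v i]‖
      ≤ ∑ _i : Fin 3, L * |t - s| * ‖h‖ := Finset.sum_le_sum fun i _ => hterm i
    _ = 3 * L * |t - s| * ‖h‖ := by simp; ring

/-- **`∂ₜ ω(t, x) = Δω − Dω[V] + DV[ω]` pointwise**, for a family with smooth slices, derivatives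
of order `≥ 1` Lipschitz in time, order `0` locally Lipschitz in time, satisfying the vorticity
equation in time-integrated form: the integrand is continuous in time, so the fundamental theorem
of calculus applies. -/
theorem hasDerivAt_curl
    (hsmooth : ∀ t < 0, ContDiff ℝ ∞ (V t))
    (hlip : ∀ k : ℕ, 1 ≤ k → ∃ L : ℝ, ∀ s < 0, ∀ t < 0, ∀ x,
      ‖iteratedFDeriv ℝ k (V t) x - iteratedFDeriv ℝ k (V s) x‖ ≤ L * |t - s|)
    (hlip0 : ∃ L : ℝ, ∀ s < 0, ∀ t < 0, ∀ x, ‖V t x - V s x‖ ≤ L * (‖x‖ + 3) * |t - s|)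
    (hvort : ∀ x, ∀ s t : ℝ, s ≤ t → t < 0 →
      curl (V t) x - curl (V s) x =
        ∫ τ in s..t, ((Δ (curl (V τ))) x - fderiv ℝ (curl (V τ)) x (V τ x) +
          fderiv ℝ (V τ) x (curl (V τ) x))) :
    ∀ t < 0, ∀ x, HasDerivAt (fun s => curl (V s) x)
      ((Δ (curl (V t))) x - fderiv ℝ (curl (V t)) x (V t x) + fderiv ℝ (V t) x (curl (V t) x)) t := by
  intro t ht x
  have hC3 : ∀ τ < 0, ContDiff ℝ 3 (V τ) := fun τ hτ => (hsmooth τ hτ).of_le (by norm_cast)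
  have hC2 : ∀ τ < 0, ContDiff ℝ 2 (V τ) := fun τ hτ => (hsmooth τ hτ).of_le (by norm_cast)
  obtain ⟨L₁, hL₁⟩ := hlip 1 le_rfl
  obtain ⟨L₂, hL₂⟩ := hlip 2 (by norm_num)
  obtain ⟨L₃, hL₃⟩ := hlip 3 (by norm_num)
  obtain ⟨L₀, hL₀⟩ := hlip0
  -- the integrand and its continuity on `(−∞, 0)`
  set F : ℝ → EuclideanSpace ℝ (Fin 3) := fun τ =>
    (Δ (curl (V τ))) x - fderiv ℝ (curl (V τ)) x (V τ x) + fderiv ℝ (V τ) x (curl (V τ) x) with hF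
  have hA : ContinuousOn (fun τ => fderiv ℝ (V τ) x) (Iio 0) := continuousOn_fderiv_of_lipschitz hL₁ x
  have hω : ContinuousOn (fun τ => curl (V τ) x) (Iio 0) := by
    simp only [curl_eq_curlCLM]
    exact curlCLM.continuous.comp_continuousOn hA
  have hB : ContinuousOn (fun τ => fderiv ℝ (curl (V τ)) x) (Iio 0) := by
    have h := (continuousOn_const (c := curlCLM)).clm_comp (continuousOn_fderiv_fderiv_of_lipschitz hL₂ x)
    refine h.congr fun τ hτ => ?_
    exact fderiv_curl (hC2 τ hτ) x
  have hC : ContinuousOn (fun τ => (Δ (curl (V τ))) x) (Iio 0) := by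
    have h := curlCLM.continuous.comp_continuousOn (continuousOn_fderiv_laplacian_of_lipschitz hC3 hL₃ x)
    refine h.congr fun τ hτ => ?_
    simp only [comp_apply, ← curl_laplacian (hC3 τ hτ) x, curl_eq_curlCLM]
  have hVx : ContinuousOn (fun τ => V τ x) (Iio 0) :=
    continuousOn_of_norm_sub_le (G := fun τ => V τ x) (L := L₀ * (‖x‖ + 3)) fun s hs τ hτ => by
      have := hL₀ s hs τ hτ x
      linarith
  have hFc : ContinuousOn F (Iio 0) := (hC.sub (hB.clm_apply hVx)).add (hA.clm_apply hω)
  -- the fundamental theorem of calculus on `(t − 1, 0)`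
  set s₀ : ℝ := t - 1 with hs₀
  have hs₀t : s₀ < t := by linarith
  have hint : IntervalIntegrable F volume s₀ t := by
    refine (hFc.mono fun τ hτ => ?_).intervalIntegrable
    rw [uIcc_of_le hs₀t.le] at hτ
    exact lt_of_le_of_lt hτ.2 ht
  have hmeasF : StronglyMeasurableAtFilter F (𝓝 t) volume :=
    hFc.stronglyMeasurableAtFilter isOpen_Iio t ht
  have hFt : ContinuousAt F t := hFc.continuousAt (isOpen_Iio.mem_nhds ht)
  have hprim : HasDerivAt (fun u => curl (V s₀) x + ∫ τ in s₀..u, F τ) (F t) t :=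
    (intervalIntegral.integral_hasDerivAt_right hint hmeasF hFt).const_add _
  refine hprim.congr_of_eventuallyEq ?_
  have hnhds : Ioo s₀ 0 ∈ 𝓝 t := isOpen_Ioo.mem_nhds ⟨hs₀t, ht⟩
  filter_upwards [hnhds] with u hu
  have := hvort x s₀ u hu.1.le hu.2
  simp only [hF]
  rw [← this]
  abel

/-- **`⟪x, Δω − Dω[W] + DW[ω]⟫ = Δg − Dg[W]`**, `ω = curl W`, `g = ⟪·, ω⟫`, for a `C³` field `W`
tangent to the spheres about the origin: `Δ⟪x, ω⟫ = ⟪x, Δω⟫ + 2 div ω`, `div curl = 0`,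
`D⟪x, ω⟫[W] = ⟪x, Dω[W]⟫ + ⟪W, ω⟫`, and `⟪x, DW[ω]⟫ = −⟪ω, W⟫` (tangency differentiated). -/
theorem inner_vorticityRHS_eq {W : EuclideanSpace ℝ (Fin 3) → EuclideanSpace ℝ (Fin 3)}
    (hW : ContDiff ℝ 3 W) (hT : ∀ y, ⟪y, W y⟫ = 0) (x : EuclideanSpace ℝ (Fin 3)) :
    ⟪x, (Δ (curl W)) x - fderiv ℝ (curl W) x (W x) + fderiv ℝ W x (curl W x)⟫ =
      (Δ fun y => ⟪y, curl W y⟫) x - fderiv ℝ (fun y => ⟪y, curl W y⟫) x (W x) := by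
  have hW2 : ContDiff ℝ 2 W := hW.of_le (by norm_cast)
  have hc2 : ContDiff ℝ 2 (curl W) := contDiff_curl (n := 2) (by exact_mod_cast hW)
  have hcd : DifferentiableAt ℝ (curl W) x := (hc2.differentiable (by norm_cast)) x
  have hWd : DifferentiableAt ℝ W x := (hW2.differentiable (by norm_cast)) x
  have h1 : (Δ fun y => ⟪y, curl W y⟫) x = ⟪x, (Δ (curl W)) x⟫ := by
    rw [laplacian_inner_id_eq hc2, divergence_curl_eq_zero_holds W hW2 x, mul_zero, add_zero]
  have h2 : fderiv ℝ (fun y => ⟪y, curl W y⟫) x (W x) =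
      ⟪x, fderiv ℝ (curl W) x (W x)⟫ + ⟪W x, curl W x⟫ := by
    rw [fderiv_inner_apply ℝ (f := fun y => y) differentiableAt_id hcd, fderiv_fun_id]
    simp
  have h3 : ⟪x, fderiv ℝ W x (curl W x)⟫ = -⟪curl W x, W x⟫ := inner_fderiv_apply_of_tangent hT hWd _
  rw [h1, h2, inner_add_right, inner_sub_right, h3, real_inner_comm (W x)]
  ring

/-- `g = ⟪·, curl W⟫` is `C²` for `W ∈ C³`. -/
theorem contDiff_inner_curl {W : EuclideanSpace ℝ (Fin 3) → EuclideanSpace ℝ (Fin 3)}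
    (hW : ContDiff ℝ 3 W) : ContDiff ℝ 2 fun y => ⟪y, curl W y⟫ :=
  contDiff_id.inner ℝ (contDiff_curl (n := 2) (by exact_mod_cast hW))

/-- `(t, x) ↦ ⟪x, curl V(t, x)⟫` is jointly continuous on `(−∞, 0) × ℝ³` for a family with `C¹`
slices whose derivatives are Lipschitz in time. -/
theorem continuousOn_uncurry_inner_curl {L : ℝ} (hC1 : ∀ t < 0, ContDiff ℝ 1 (V t))
    (hL : ∀ s < 0, ∀ t < 0, ∀ x, ‖iteratedFDeriv ℝ 1 (V t) x - iteratedFDeriv ℝ 1 (V s) x‖ ≤ L * |t - s|) :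
    ContinuousOn (uncurry fun t x => ⟪x, curl (V t) x⟫) (Iio 0 ×ˢ univ) := by
  have hD : ContinuousOn (fun p : ℝ × EuclideanSpace ℝ (Fin 3) => fderiv ℝ (V p.1) p.2) (Iio 0 ×ˢ univ) := by
    refine continuousOn_uncurry_of_forall_dist_le (F := fun t x => fderiv ℝ (V t) x) (L := L)
      (fun t ht => (hC1 t ht).continuous_fderiv one_ne_zero) fun s hs t ht x => ?_
    rw [dist_eq_norm]
    refine ContinuousLinearMap.opNorm_le_bound _ ((norm_nonneg _).trans (hL s hs t ht x)) fun h => ?_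
    have key : (fderiv ℝ (V t) x - fderiv ℝ (V s) x) h =
        (iteratedFDeriv ℝ 1 (V t) x - iteratedFDeriv ℝ 1 (V s) x) (fun _ => h) := by
      change fderiv ℝ (V t) x h - fderiv ℝ (V s) x h =
        iteratedFDeriv ℝ 1 (V t) x (fun _ => h) - iteratedFDeriv ℝ 1 (V s) x (fun _ => h)
      rw [iteratedFDeriv_one_apply, iteratedFDeriv_one_apply]
    rw [key]
    refine (ContinuousMultilinearMap.le_opNorm _ _).trans ?_
    rw [Fin.prod_univ_one]
    exact mul_le_mul_of_nonneg_right (hL s hs t ht x) (norm_nonneg _)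
  have h : ContinuousOn (fun p : ℝ × EuclideanSpace ℝ (Fin 3) => ⟪p.2, curlCLM (fderiv ℝ (V p.1) p.2)⟫)
      (Iio 0 ×ˢ univ) :=
    continuous_snd.continuousOn.inner (curlCLM.continuous.comp_continuousOn hD)
  refine h.congr fun p _ => ?_
  simp only [uncurry, curl_eq_curlCLM]

end Family

end Summit.NavierStokesRegularity.NavierStokesRegularity.Theorems
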